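import Summits.CriticalPhenomena.SAWScalingLimit.Theorems.SAWDefectDecoherenceBoundaryClosureRZigzagDiscretisation
import Summits.CriticalPhenomena.SAWScalingLimit.Theorems.SAWDefectDecoherenceBoundaryClosureRInnerZigzagSep
import Summits.CriticalPhenomena.SAWScalingLimit.Theorems.BoundaryClosureR.Negative.FlatGateBudget
import HarnessLib

/-!
# Crux `BoundaryClosureR` (stmt-CriticalPhenomena-14004), line `polygon-parity-squeeze`,
# stub `exactPolygonDatum_exists`: NON-VACUITY of the hypothesis class of the identification theorem

Landing target:
`Summits/CriticalPhenomena/SAWScalingLimit/Theorems/SAWDefectDecoherenceBoundaryClosureRExactPolygonDatum.lean`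
(`--supports stmt-CriticalPhenomena-14004`).

**Statement** (`exactPolygonDatum_exists`, registered verbatim).  There is a Dobrushin datum
`(D; ρ, Λ, m, b; a, r₀, m₀)` which is an ADMISSIBLE family (`AdmissibleFamily D ρ Λ m b`), an EXACT
POLYGON family (`ExactPolygonFamily D Λ`) and PINNED at the root (`PinnedFlatRoot D Λ b (D.pt 0) a r₀ m₀`),
with disjoint pinned balls in the sense `2ρ < dist (pt 0) (pt 1)`.  So the hypothesis class of the
line's identification theorem on exact polygons is not empty (kernel-level sanity of the vocabulary
`…PolygonParitySqueezeDefs`).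

**Proof.**
1. ONE admissible pinned datum is read off the refuters' half-disc witness of
   `Negative/FlatGateBudget.lean` (`not_flatGateBudget`): `D₀ = halfDiscDomain (1/5)` (`pt 0 = 1/5`,
   `pt 1 = 0`), `Λ δ = Lam δ false`, `m = m₀ = 0`, `b δ = bEdge`, `a δ = hang (kOf δ)`, radii `1/12`
   (flat half-plane balls `HD_inter_ball_real`, `simplyConnected_Lam`, `bEdge_mem_boundary`,
   `hang_mem_boundary`, `nonempty_saw_hang`, `preconnected_Lam`, `smul_center_mem_HD`,
   `mem_Lam_iff_of_ball`, exhaustion `mem_Lam_of_thick`, limits `tendsto_smul_midpoint_bEdge`,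
   `tendsto_smul_midpoint_hang`); `dist (pt 0) (pt 1) = 1/5 > 2/12`.
2. The landed inner-polygon theorem (IP) = `stub_innerPolygonsOfZigzag ∘ stub_innerZigzagPolygonSep`
   (files `…ZigzagDiscretisation.lean`, `…InnerZigzagSep.lean`) applied to this datum with collar
   width `η = 1` returns an inner polygon `P` with the same marked points and an exact polygon family
   `Λ^P` of `P`, admissible (radius `ρ/2`) and pinned (radius `min r₀ ρ/4`): the required datum.

Sources: H. Duminil-Copin, S. Smirnov, Ann. of Math. 175 (2012) §2–§3; folklore.  Everything here is
proved; no definition and no named fact is introduced.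
-/

noncomputable section

open scoped Topology
open Set Metric Filter
open Literature.Probability.LatticeModels Literature.Probability.RandomPlanarGeometry
  Literature.Probability.RandomPlanarGeometry.SAW
open Summit.CriticalPhenomena.SAWScalingLimit.Theorems.BoundaryClosure.Negative
open Summit.CriticalPhenomena.SAWScalingLimit.Theorems.BoundaryClosureR.Negative

namespace Summit.CriticalPhenomena.SAWScalingLimit.Theorems.PolygonParitySqueeze

namespace ExactPolygonDatum

/-- `0 < 1/5 < 1`: the root `1/5` is an admissible marked point of the half-disc. [folklore] -/
theorem hr15 : (0 : ℝ) < 1 / 5 ∧ (1 / 5 : ℝ) < 1 := by norm_num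

/-- The distance of the two marked points of `halfDiscDomain (1/5)` is `1/5`. [folklore] -/
theorem dist_pt_halfDisc :
    dist ((halfDiscDomain (1 / 5) hr15).pt 0) ((halfDiscDomain (1 / 5) hr15).pt 1) = 1 / 5 := by
  rw [pt_zero_halfDiscDomain, pt_one_halfDiscDomain, dist_zero_right, Complex.norm_real,
    Real.norm_of_nonneg (by norm_num)]

/-- **The half-disc witness is an admissible family** (radius `1/12` at the normaliser `pt 1 = 0`):
the cycle-1 family `Lam δ false`, gate row `0`, normaliser `bEdge`.
[cite: DuminilCopinSmirnov2012, §2 (domains) and Conjecture 2] -/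
theorem admissibleFamily_halfDisc :
    AdmissibleFamily (halfDiscDomain (1 / 5) hr15) (1 / 12) (fun δ => Lam δ false) (fun _ => 0)
      (fun _ => bEdge) := by
  refine ⟨by norm_num, ?_, ?_, ?_, ?_⟩
  · rw [pt_one_halfDiscDomain]
    show HD ∩ _ = _
    simpa using HD_inter_ball_real (p := 0) (ρ := 1 / 12) (by norm_num)
  · filter_upwards [eventually_small one_pos] with δ hδ
    obtain ⟨hδ, hδ', -⟩ := hδ
    refine ⟨simplyConnected_Lam hδ hδ' false, bEdge_mem_boundary hδ hδ' false,
      preconnected_Lam hδ hδ' false, fun v hv => smul_center_mem_HD hδ hδ' false hv, fun v hv => ?_⟩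
    rw [pt_one_halfDiscDomain, Metric.mem_ball] at hv
    refine mem_Lam_iff_of_ball hδ hδ' false ?_
    rw [Metric.mem_ball]
    linarith
  · intro K hK hKD
    obtain ⟨ε, hε, -, hthick⟩ := exists_thick_of_isCompact hK hKD
    filter_upwards [eventually_small (by positivity : 0 < ε / 4)] with δ hδ v hv
    obtain ⟨hδ, hδ', hδε⟩ := hδ
    obtain ⟨hn, hi⟩ := hthick _ hv
    exact mem_Lam_of_thick hδ hδ' false hδε hn hi
  · rw [pt_one_halfDiscDomain]
    exact tendsto_smul_midpoint_bEdge

/-- **The half-disc witness is pinned at the root** `pt 0 = 1/5` (radius `1/12`): root edges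
`hang (kOf δ)`, root row `0`, walks to the normaliser exist.
[cite: DuminilCopinSmirnov2012, §2 (boundary mid-edges, winding)] -/
theorem pinnedFlatRoot_halfDisc :
    PinnedFlatRoot (halfDiscDomain (1 / 5) hr15) (fun δ => Lam δ false) (fun _ => bEdge)
      ((halfDiscDomain (1 / 5) hr15).pt 0) (fun δ => hang (kOf δ)) (1 / 12) (fun _ => 0) := by
  rw [pt_zero_halfDiscDomain]
  refine ⟨by norm_num, ?_, ?_, ?_⟩
  · show HD ∩ _ = _
    exact HD_inter_ball_real (p := 1 / 5) (ρ := 1 / 12) (by rw [abs_of_pos hr15.1]; norm_num)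
  · filter_upwards [eventually_small one_pos] with δ hδ
    obtain ⟨hδ, hδ', -⟩ := hδ
    refine ⟨hang_mem_boundary hδ hδ', nonempty_saw_hang hδ hδ', fun v hv => ?_⟩
    rw [Metric.mem_ball] at hv
    refine mem_Lam_iff_of_ball hδ hδ' false ?_
    rw [Metric.mem_ball]
    have h2 : dist (((1 / 5 : ℝ) : ℂ)) 0 = 1 / 5 := by
      rw [dist_zero_right, Complex.norm_real, Real.norm_of_nonneg (by norm_num)]
    calc dist ((δ : ℂ) * hexCenter v) 0
        ≤ dist ((δ : ℂ) * hexCenter v) ((1 / 5 : ℝ) : ℂ) + dist (((1 / 5 : ℝ) : ℂ)) 0 :=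
          dist_triangle _ _ _
      _ < 1 / 12 + 1 / 5 := by rw [h2]; linarith
      _ ≤ 1 / 2 := by norm_num
  · exact tendsto_smul_midpoint_hang

end ExactPolygonDatum

open ExactPolygonDatum in
/-- **Non-vacuity of the hypothesis class of the identification theorem on exact polygons**: an
admissible EXACT POLYGON pinned datum with disjoint pinned balls exists — the inner exact polygon
(landed (IP) = `stub_innerPolygonsOfZigzag ∘ stub_innerZigzagPolygonSep`, collar width `1`) of the
refuters' half-disc witness `(halfDiscDomain (1/5); Lam δ false, bEdge, hang (kOf δ))` at radii `1/12`.
[cite: DuminilCopinSmirnov2012, §2–§3 (domains, lattice approximation) and Conjecture 2] -/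
theorem exactPolygonDatum_exists : ∃ (D : DobrushinDomain) (ρ : ℝ) (Λ : ℝ → Finset HexVertex) (m : ℝ → ℤ) (b : ℝ → Sym2 HexVertex) (a : ℝ → Sym2 HexVertex) (r₀ : ℝ) (m₀ : ℝ → ℤ), AdmissibleFamily D ρ Λ m b ∧ ExactPolygonFamily D Λ ∧ PinnedFlatRoot D Λ b (D.pt 0) a r₀ m₀ ∧ 2 * ρ < dist (D.pt 0) (D.pt 1) := by
  have hdist : 2 * (1 / 12 : ℝ) <
      dist ((halfDiscDomain (1 / 5) hr15).pt 0) ((halfDiscDomain (1 / 5) hr15).pt 1) := by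
    rw [dist_pt_halfDisc]; norm_num
  obtain ⟨P, ΛP, h0, h1, -, -, hAF, hEPF, hPR, -⟩ :=
    stub_innerPolygonsOfZigzag stub_innerZigzagPolygonSep (halfDiscDomain (1 / 5) hr15) (1 / 12)
      (fun δ => Lam δ false) (fun _ => 0) (fun _ => bEdge) admissibleFamily_halfDisc
      (fun δ => hang (kOf δ)) (1 / 12) (fun _ => 0) pinnedFlatRoot_halfDisc hdist 1 one_pos
  refine ⟨P, 1 / 12 / 2, fun δ => ΛP δ, fun _ => 0, fun _ => bEdge, fun δ => hang (kOf δ),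
    min (1 / 12) (1 / 12) / 4, fun _ => 0, hAF, hEPF, hPR, ?_⟩
  rw [h0, h1, dist_pt_halfDisc]
  norm_num

end Summit.CriticalPhenomena.SAWScalingLimit.Theorems.PolygonParitySqueeze

end
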